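import Summits.BirchSwinnertonDyer.BirchSwinnertonDyer.Theorems.KimAtThreeKolyvaginIsogenyCruxes
import Summits.BirchSwinnertonDyer.BirchSwinnertonDyer.Theorems.KimAtThreeDeepUpperEndRow
import HarnessLib

/-!
# Route `KimAtThreeKolyvagin` (rung W2), crux `DeepUpperAtThree` (item 19076): the crux FROM w2-c3's
# END-core inputs at every depth on OPTIMAL parametrised curves only

Cell `bsd-addord`, seat `bsd-addord-kim3` (gen 9). TOOL FILE: one theorem (no definition, no named fact, no
`sorry`); closes nothing (the hypothesis is crux-sized), books nothing. It composes
* w2-c3's row-level `EndRow.deepUpper_conclusion_of_endCoreInputs` (p425782: on a row with datum `P`,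
  the END-core inputs at every depth — cell n1011's DICT3 witness clauses `KatoKuriharaWitnessAt`, a
  generator of `KS₁`, the Poitou–Tate count, the STUB decomposition at `∅`, `#Sel_{3^K} = #Ш(3)`, the
  `L`-value visibility with `t + a < K`, one good core vertex — give crux 19076's conclusion for `P.f`), with
* kim3 g9's `deepUpperAtThree_of_forall_optimalDatum` (p425479: the crux follows from its restriction to
  globally minimal `W₀` carrying a lattice-OPTIMAL, degree-MINIMAL datum `D₀` at the level of `f`, `D₀.f = f`),
so that the witness PRODUCERS a successor has to supply (the dictionary port is keyed to the datum and to
the period transfer `Ω(W₀) = |c₀|·Ω⁺_f`, which only an optimal datum affords for free) need only exist on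
optimal data: `deepUpperAtThree_of_endCoreInputs_optimal`. The hypothesis block is `EndRow`'s `H`
VERBATIM with `(W, P) := (W₀, D₀)`, preceded by the choice of `t`, `v₃ ∣ 3`, `a = ∂⁽⁰⁾` and `B`.

References: [Kim2022StructureSelmer] Thm. 1.9 (6), Thm. 3.13; [MazurRubin2004] Thm. 4.3.4, Cor. 4.1.9,
Thm. 5.2.12 (v); [Kim2025RefinedTNC] Thm 1.1, §5; [EdixhovenManin1991] Prop. 2; memo
`run/shared/lean/pub/bsd-addord/kim3/KIM3-W2-ISOGENY-g9.md`.
-/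

-- the Theorems namespace of a single-conjunct summit repeats the summit name by design (D-0017)
set_option linter.dupNamespace false

noncomputable section

open scoped Classical NumberField ContRepresentation
open Function NumberField IsDedekindDomain WeierstrassCurve CongruenceSubgroup
  Literature.NumberTheory.EllipticCurves Literature.NumberTheory.EllipticCurves.ModularForms
  Literature.NumberTheory.GaloisRepresentations Literature.NumberTheory.GaloisCohomology
  Summit.BirchSwinnertonDyer.Rank1Residual.GaloisImage
  Summit.BirchSwinnertonDyer.BirchSwinnertonDyer.Theses.KimAtThreeKolyvagin
  Summit.BirchSwinnertonDyer.BirchSwinnertonDyer.Theorems.KimAtThreeKolyvaginIsogenyCruxes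
  Summit.BirchSwinnertonDyer.BirchSwinnertonDyer.Theorems.KimAtThreeDeepUpperEndRow

namespace Summit.BirchSwinnertonDyer.BirchSwinnertonDyer.Theorems.KimAtThreeKolyvaginIsogenyEndRow

/-- **Crux `DeepUpperAtThree` ⟸ w2-c3's END-core inputs at every depth on every OPTIMAL parametrised
tower row.** If for every globally minimal `W₀` with the `3`-adic tower onto and `Ш` finite, and every
lattice-optimal, degree-minimal datum `D₀` of `W₀` (any level) with `3`-integral plus symbols and
`ord(δ̃) = 0`, there are `t`, a place `v₃ ∣ 3`, the value `a = ∂⁽⁰⁾(δ̃)` and a bound `B` such that the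
hypothesis `H` of `EndRow.deepUpper_conclusion_of_endCoreInputs` holds at `(W₀, D₀)`, then
`DeepUpperAtThree` holds (for EVERY tower row and newform, by the isogeny transport). [cite: Kim2025RefinedTNC, Thm 1.1, §5]
[cite: Kim2022StructureSelmer, Thm. 1.9 (6), Thm. 3.13] [cite: EdixhovenManin1991, Prop. 2] -/
theorem deepUpperAtThree_of_endCoreInputs_optimal
    (h : ∀ (W₀ : WeierstrassCurve ℚ) [W₀.IsElliptic] [W₀.IsGloballyMinimal],
      (∀ n : ℕ, W₀.HasSurjectiveModNGaloisRep (3 ^ n : ℕ)) → Finite W₀.sha →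
      ∀ {N : ℕ} [NeZero N] (D₀ : ModularParametrizationData W₀ N),
        (∀ z ∈ D₀.L.lattice, ∃ w ∈ periodLattice D₀.f, z = D₀.c * w) →
        (∀ (W₂ : WeierstrassCurve ℚ) [W₂.IsElliptic] (D₂ : ModularParametrizationData W₂ N),
          D₂.f = D₀.f → D₀.modularDegree ≤ D₂.modularDegree) →
        (∀ r : ℚ, ratPlusSymbol D₀.f r ≠ 0 → 0 ≤ padicValRat 3 (ratPlusSymbol D₀.f r)) →
        kuriharaVanishingOrder W₀ 3 D₀.f = 0 →
        ∃ (t : ℕ) (v₃ : HeightOneSpectrum (𝓞 ℚ)) (_ : ((3 : ℕ) : 𝓞 ℚ) ∈ v₃.asIdeal) (a : ℕ)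
          (_ : kuriharaPartial W₀ 3 D₀.f 0 = a) (B : ℕ),
          ∀ k₀, a - padicValNat 3 (Nat.card (AddCommGroup.primaryComponent W₀.sha 3)) < k₀ →
          ∃ (k : ℕ) (D : KolyvaginDatum (W₀.torsionGaloisModule (((3 : ℕ) : ℤ) ^ k * ((3 : ℕ) : ℤ))))
          (κ : Finset (HeightOneSpectrum (𝓞 ℚ)) →
          galoisCohomology (W₀.torsionGaloisModule (((3 : ℕ) : ℤ) ^ k * ((3 : ℕ) : ℤ))) 1)
          (Λ : galoisCohomology ((W₀.torsionGaloisModule (((3 : ℕ) : ℤ) ^ k * ((3 : ℕ) : ℤ))).toLocal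
          (Sum.inr v₃)) 1 →+ ZMod (3 ^ (k + 1)))
          (κ' : Finset (HeightOneSpectrum (𝓞 ℚ)) →
          galoisCohomology (W₀.torsionGaloisModule (((3 : ℕ) : ℤ) ^ k * ((3 : ℕ) : ℤ))) 1)
          (_ : KatoKuriharaWitnessAt W₀ k t D v₃ D₀ κ Λ κ')
          (g : Finset (HeightOneSpectrum (𝓞 ℚ)) →
          galoisCohomology (W₀.torsionGaloisModule (((3 : ℕ) : ℤ) ^ k * ((3 : ℕ) : ℤ))) 1)
          (_ : ∀ κ'' ∈ D.kolyvaginSystems (propagatedSelmerStructure W₀ 3 k), ∃ a' : ℕ, κ'' = a' • g)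
          (n₀ : ℕ) (_ : Nat.card (propagatedSelmerStructure W₀ 3 k).selmerGroup = 3 ^ (k + 1) * 3 ^ n₀)
          (_ : ∃ e ∈ (propagatedSelmerStructure W₀ 3 k).selmerGroup,
          ∃ m ∈ (W₀.kummerSelmerStructure (((3 : ℕ) : ℤ) ^ k * ((3 : ℕ) : ℤ))).selmerGroup,
          g ∅ = 3 ^ n₀ • e + m)
          (_ : Nat.card (W₀.kummerSelmerStructure (((3 : ℕ) : ℤ) ^ k * ((3 : ℕ) : ℤ))).selmerGroup =
          Nat.card (AddCommGroup.primaryComponent W₀.sha 3))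
          (_ : t + a < k + 1) (w₀ : (ZMod (3 ^ (k + 1)))ˣ)
          (_ : ∀ ψ : (ℓ : ℕ) → (ZMod ℓ)ˣ →* Multiplicative (ZMod (3 ^ (k + 1))),
          kuriharaNumber D₀.f (3 ^ (k + 1)) 1 ψ = ((3 ^ a : ℕ) : ZMod (3 ^ (k + 1))) * (w₀ : ZMod _))
          (d : Finset (HeightOneSpectrum (𝓞 ℚ))) (_ : D.IsLevel d)
          (_ : ∀ q ∈ d, (Ideal.absNorm q.asIdeal).Prime)
          (_ : IsCyclicKolyvaginLevel W₀ 3 (∏ q ∈ d, Ideal.absNorm q.asIdeal))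
          (_ : Kato.IsKolyvaginProduct W₀ 3 k₀ (∏ q ∈ d, Ideal.absNorm q.asIdeal))
          (_ : (∏ q ∈ d, Ideal.absNorm q.asIdeal).primeFactors.card ≤ B)
          (_ : ∀ x ∈ (D.atLevel (propagatedSelmerStructure W₀ 3 k) d).selmerGroup,
          Λ (galoisCohomology.localization _ (Sum.inr v₃) 1 x) = 0 → x = 0)
          (_ : g d ∈ (D.atLevel (propagatedSelmerStructure W₀ 3 k) d).selmerGroup),
          addOrderOf (g d) = 3 ^ (k + 1)) :
    DeepUpperAtThree := by
  refine deepUpperAtThree_of_forall_optimalDatum fun W₀ _ _ htow hfin N _ D₀ hopt hdeg hint hord => ?_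
  obtain ⟨t, v₃, hv₃, a, ha, B, H⟩ := h W₀ htow hfin D₀ hopt hdeg hint hord
  exact EndRow.deepUpper_conclusion_of_endCoreInputs W₀ t v₃ hv₃ D₀ hint ha B H

end Summit.BirchSwinnertonDyer.BirchSwinnertonDyer.Theorems.KimAtThreeKolyvaginIsogenyEndRow

end
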